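import Summits.Ventures.PercRepro.ThetaSet
import Summits.Ventures.PercRepro.MSTightDefectB
import Summits.Ventures.PercRepro.MSTightBlock

/-!
# (Θ) with at most two pairs of some type, modulo Conjecture V

`ThetaSet.lean` proves the set-world coloured Marica–Schönheim statement (Θ) when some type has
at most one pair. This file extends it to **at most two pairs**, modulo one structural
conjecture (`ConjV`): an MS-excess-1 family `F` (disjoint from its complement family) with a
near-member `u` — all required cells among its differences for some sign pattern — and with
neither `F ∪ {u}` nor `F ∪ {uᶜ}` tight is a block family (`F \\ F = insert ∅ F`) or the mirror of
one (`F \\ F = insert ∅ (compls F)`). The chain (`theta_card_le_of_card_le_two_of_conjV`, paper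
proofs/MINE1-theoremS.md Addendum 3): for a violating instance with `B = {u, u'}` and
`F = A ∪ Cᶜ`, the one-pair theorem on `(A, {u}, C)` and `(A, {u'}, C)` forces
`thetaD A B C = thetaD A {u} C = thetaD A {u'} C` of size `|A| + |C| + 1`; if `F` is tight, the
single new element `e` is a common defect and Lemma U (`eq_of_cells_subset_insert`) gives
`u' = u`; otherwise `F \\ F = thetaD A B C`, and a tight extension `F ∪ {u}` or `F ∪ {uᶜ}` lets
the general mixed-cell lemma on the extension (`mem_or_compl_mem_of_tight_insert` and its
agreement form) put `u'` or `u'ᶜ` into it; in the remaining case Conjecture V makes `F` a block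
family and the block step (`eq_of_diffs_eq_insert_empty` / `_compl`) gives `u' = u` again.
-/

namespace PercRepro.MSTight

open Finset
open scoped FinsetFamily

variable {α : Type*} [DecidableEq α] [Fintype α]

/-- **Conjecture V** (candidate proposition, never asserted): an MS-excess-1 family disjoint from
its complement family, with a near-member `u` for the sign pattern `σ` and with neither
`F ∪ {u}` nor `F ∪ {uᶜ}` tight, is a block family or the mirror of one. -/
def ConjV (α : Type*) [DecidableEq α] [Fintype α] : Prop :=
  ∀ (F : Finset (Finset α)) (σ : Finset α → Bool) (u : Finset α),
    Disjoint F (compls F) → (F \\ F).card = F.card + 1 → u ∉ F → Finset.univ \ u ∉ F →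
    (∀ t ∈ F, Cells (F \\ F) t (if σ t = true then u else Finset.univ \ u)) →
    ¬ Tight (insert u F) → ¬ Tight (insert (Finset.univ \ u) F) →
    F \\ F = insert ∅ F ∨ F \\ F = insert ∅ (compls F)

/-- Cells are monotone in the difference family. -/
theorem cells_mono {D D' : Finset (Finset α)} (h : D ⊆ D') {t v : Finset α} (hc : Cells D t v) :
    Cells D' t v :=
  ⟨h hc.1, h hc.2⟩

/-- **The tight-extension step, agreement form.** If `F ∪ {uᶜ}` is tight and `u'` has all its
required cells with respect to `(F, σ)`, together with `u \ u'` and `u' \ u`, among the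
differences of `F ∪ {uᶜ}`, then `u'` or `u'ᶜ` is a member of `F ∪ {uᶜ}` — sign `uᶜ` as an
agreement member. -/
theorem mem_or_compl_mem_of_tight_insert_compl {F : Finset (Finset α)} {u : Finset α}
    (hF : Tight (insert (Finset.univ \ u) F)) (σ : Finset α → Bool) {u' : Finset α}
    (h : ∀ t ∈ F, Cells (insert (Finset.univ \ u) F \\ insert (Finset.univ \ u) F) t
      (if σ t = true then u' else Finset.univ \ u'))
    (h1 : u \ u' ∈ insert (Finset.univ \ u) F \\ insert (Finset.univ \ u) F)
    (h2 : u' \ u ∈ insert (Finset.univ \ u) F \\ insert (Finset.univ \ u) F) :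
    u' ∈ insert (Finset.univ \ u) F ∨ Finset.univ \ u' ∈ insert (Finset.univ \ u) F := by
  refine mem_or_compl_mem_of_tight hF (insert_nonempty _ F) u' ?_
  intro t ht
  rcases mem_insert.1 ht with rfl | htF
  · left
    have e1 : (Finset.univ \ u) ∩ u' = u' \ u := by ext x; simp [and_comm]
    have e2 : (Finset.univ \ (Finset.univ \ u)) ∩ (Finset.univ \ u') = u \ u' := by
      ext x; simp
    rw [e1, e2]
    exact ⟨h2, h1⟩
  · have hc := h t htF
    by_cases hσ : σ t = true
    · rw [if_pos hσ] at hc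
      exact Or.inl hc
    · rw [if_neg hσ] at hc
      obtain ⟨hc1, hc2⟩ := hc
      rw [Finset.sdiff_sdiff_eq_self (subset_univ u')] at hc2
      exact Or.inr ⟨hc1, hc2⟩

/-- **(Θ) with at most two pairs of the middle type, modulo Conjecture V.** -/
theorem theta_card_le_of_card_le_two_of_conjV (hV : ConjV α) {A B C : Finset (Finset α)}
    (h : ThetaValid A B C) (hB : B.card ≤ 2) :
    A.card + B.card + C.card ≤ (thetaD A B C).card := by
  rcases Nat.lt_or_ge B.card 2 with hlt | hge
  · exact theta_card_le_of_card_le_one h (by omega)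
  have hB2 : B.card = 2 := le_antisymm hB hge
  obtain ⟨u, u', huu', hBeq⟩ := card_eq_two.1 hB2
  have hu : u ∈ B := by rw [hBeq]; exact mem_insert_self _ _
  have hu' : u' ∈ B := by rw [hBeq]; exact mem_insert_of_mem (mem_singleton_self _)
  rw [hB2]
  by_contra hlt
  push Not at hlt
  set F := transversal A C with hFdef
  set D := thetaD A B C with hDdef
  have hcardF : F.card = A.card + C.card := card_transversal (B := B) h
  -- the one-pair sub-instances fill `D` exactly
  have sub1 : ∀ v ∈ B, D.card = A.card + C.card + 1 := by
    intro v hv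
    have hval := thetaValid_singleton h hv
    have hreg := theta_card_le_of_card_le_one hval (by simp)
    rw [card_singleton] at hreg
    have hsub : thetaD A {v} C ⊆ D := thetaD_mono_mid (singleton_subset_iff.2 hv)
    have := card_le_card hsub
    omega
  have hDcard := sub1 u hu
  have hFD : F \\ F ⊆ D := diffs_transversal_subset A B C
  have hMS : F.card ≤ (F \\ F).card := Finset.card_le_card_diffs F
  have hFDc : (F \\ F).card ≤ D.card := card_le_card hFD
  have hcu : ∀ t ∈ F, Cells D t (if decide (t ∈ A) = true then u else Finset.univ \ u) :=
    cells_mem_thetaD_signed hu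
  have hcu' : ∀ t ∈ F, Cells D t (if decide (t ∈ A) = true then u' else Finset.univ \ u') :=
    cells_mem_thetaD_signed hu'
  have hxD : u \ u' ∈ D := mem_thetaD_of_mem_diffs_mid (mem_diffs.2 ⟨u, hu, u', hu', rfl⟩)
  have hyD : u' \ u ∈ D := mem_thetaD_of_mem_diffs_mid (mem_diffs.2 ⟨u', hu', u, hu, rfl⟩)
  obtain ⟨hu1, hu2⟩ : u ∉ F ∧ Finset.univ \ u ∉ F := notMem_transversal h hu
  obtain ⟨hu1', hu2'⟩ : u' ∉ F ∧ Finset.univ \ u' ∉ F := notMem_transversal h hu'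
  have hne_compl : Finset.univ \ u' ≠ u := by
    intro heq
    have : u ∈ compls B := heq ▸ compl_mem_compls hu'
    exact disjoint_left.1 h.2.1 hu this
  have h0D : (∅ : Finset α) ∈ D :=
    mem_thetaD_of_mem_diffs_mid (mem_diffs.2 ⟨u, hu, u, hu, Finset.sdiff_self u⟩)
  -- the transversal is nonempty: otherwise `D` would have one element but contains `∅` and a
  -- nonempty difference of `u`, `u'`
  have hFne : F.Nonempty := by
    by_contra hemp
    rw [not_nonempty_iff_eq_empty] at hemp
    rw [hemp, card_empty] at hcardF
    have hD1 : D.card = 1 := by omega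
    have hxy : u \ u' ≠ ∅ ∨ u' \ u ≠ ∅ := by
      by_contra hcon
      push Not at hcon
      exact huu' (Finset.Subset.antisymm (sdiff_eq_empty_iff_subset.1 hcon.1)
        (sdiff_eq_empty_iff_subset.1 hcon.2))
    have two : ∀ z ∈ D, z ≠ ∅ → 2 ≤ D.card := by
      intro z hz hzne
      calc 2 = ({∅, z} : Finset (Finset α)).card := (card_pair (Ne.symm hzne)).symm
        _ ≤ D.card := card_le_card (by
          intro w hw
          rcases mem_insert.1 hw with rfl | hw
          · exact h0D
          · rw [mem_singleton.1 hw]; exact hz)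
    rcases hxy with hx | hy
    · have := two _ hxD hx; omega
    · have := two _ hyD hy; omega
  by_cases hT : Tight F
  · -- `F` tight: `D = insert e (F \\ F)` with a single defect `e`, and Lemma U
    have hcardD : (F \\ F).card < D.card := by unfold Tight at hT; omega
    obtain ⟨e, heD, heF⟩ := exists_mem_notMem_of_card_lt_card hcardD
    have hDeq : D = insert e (F \\ F) := by
      symm
      apply eq_of_subset_of_card_le
      · intro z hz
        rcases mem_insert.1 hz with rfl | hz
        · exact heD
        · exact hFD hz
      · rw [card_insert_of_notMem heF]
        unfold Tight at hT
        omega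
    rw [hDeq] at hcu hcu'
    exact huu' (eq_of_cells_subset_insert hT hFne (fun t => decide (t ∈ A)) heF hu1 hu2 hu1' hu2'
      hcu hcu').symm
  · -- `F` has excess exactly one and `F \\ F = D`
    have hex : (F \\ F).card = F.card + 1 := by unfold Tight at hT; omega
    have hDF : F \\ F = D := eq_of_subset_of_card_le hFD (by omega)
    rw [← hDF] at hcu hcu' hxD hyD
    by_cases ht1 : Tight (insert u F)
    · have hsub : F \\ F ⊆ insert u F \\ insert u F :=
        diffs_subset (subset_insert _ _) (subset_insert _ _)
      rcases mem_or_compl_mem_of_tight_insert ht1 (fun t => decide (t ∈ A))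
          (fun t ht => cells_mono hsub (hcu' t ht)) (hsub hxD) (hsub hyD) with h' | h'
      · rcases mem_insert.1 h' with h'' | h''
        · exact huu' h''.symm
        · exact hu1' h''
      · rcases mem_insert.1 h' with h'' | h''
        · exact hne_compl h''
        · exact hu2' h''
    by_cases ht2 : Tight (insert (Finset.univ \ u) F)
    · have hsub : F \\ F ⊆ insert (Finset.univ \ u) F \\ insert (Finset.univ \ u) F :=
        diffs_subset (subset_insert _ _) (subset_insert _ _)
      rcases mem_or_compl_mem_of_tight_insert_compl ht2 (fun t => decide (t ∈ A))
          (fun t ht => cells_mono hsub (hcu' t ht)) (hsub hxD) (hsub hyD) with h' | h'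
      · rcases mem_insert.1 h' with h'' | h''
        · exact hne_compl (by rw [h'', Finset.sdiff_sdiff_eq_self (subset_univ u)])
        · exact hu1' h''
      · rcases mem_insert.1 h' with h'' | h''
        · exact huu' (by
            have := congrArg (fun s => Finset.univ \ s) h''
            simpa [Finset.sdiff_sdiff_eq_self (subset_univ u), Finset.sdiff_sdiff_eq_self (subset_univ u')]
              using this.symm)
        · exact hu2' h''
    -- the residue: Conjecture V and the block step
    have hdisj := disjoint_transversal_compls (B := B) h
    rcases hV F (fun t => decide (t ∈ A)) u hdisj hex hu1 hu2 hcu ht1 ht2 with hblock | hblock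
    · exact huu' (eq_of_diffs_eq_insert_empty hblock _ hu1 hu2 hu1' hu2' hcu hcu' hxD hyD).symm
    · exact huu' (eq_of_diffs_eq_insert_empty_compl hblock _ hu1 hu2 hu1' hu2' hcu hcu' hxD
        hyD).symm

/-- **(Θ) whenever some type has at most two pairs, modulo Conjecture V.** -/
theorem theta_card_le_of_some_card_le_two_of_conjV (hV : ConjV α) {A B C : Finset (Finset α)}
    (h : ThetaValid A B C) (hsmall : A.card ≤ 2 ∨ B.card ≤ 2 ∨ C.card ≤ 2) :
    A.card + B.card + C.card ≤ (thetaD A B C).card := by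
  rcases hsmall with hA | hB | hC
  · have := theta_card_le_of_card_le_two_of_conjV hV (thetaValid_rotate (thetaValid_rotate h)) hA
    rw [thetaD_rotate, thetaD_rotate] at this
    omega
  · exact theta_card_le_of_card_le_two_of_conjV hV h hB
  · have := theta_card_le_of_card_le_two_of_conjV hV (thetaValid_rotate h) hC
    rw [thetaD_rotate] at this
    omega

end PercRepro.MSTight
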